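import Mathlib
import HarnessLib
import Summits.ResolutionOfSingularities.ResolutionOfSingularities.Theorems.HomologicalConductorNoZenoExitDivisor

/-!
# Crux `NoZenoR` / `NoZeno` (stmt-ResolutionOfSingularities-19943 / -16483), line
# `sandwich-cluster`, Ga side conditions: `𝔪^c ⊆ ca(T_m)` and a non-zero element of `ca(T_m)`

Route `ResolutionOfSingularities/HomologicalConductor`.  OURS (cell res-hironaka, crux chain W4.4,
seat res-L0-w44-stub-5 = res-D-pv-037); nothing here is a statement of the manuscript under review
(Hironaka 2017); AI-written, weaker than expert review.

Two inputs of the lead's Ga assembly `caCarried_of_pieces` (`…NoZenoCaCarriedAssembly.lean`: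
`(c) (hc : maximalIdeal T ^ c ≤ cohomologyAnnihilator T)` and `(y) (hy0 : y ≠ 0) (hy : y ∈ ca T)`)
at a stage `T = T_(n+1)` of the sandwiched tower:

* `exists_maximalIdeal_pow_le_cohomologyAnnihilator_tower` — `𝔪^c ⊆ ca(T_(n+1))` for some `c`:
  every prime containing `ca` is maximal (`isMaximal_of_ca_le`, Iyengar–Takahashi 5.4 + `(R₁)` of
  the normal two-dimensional stage), so `√ca ⊇ 𝔪` and `𝔪` is finitely generated;
* `exists_ne_zero_mem_cohomologyAnnihilator_tower` — at a SINGULAR stage (not a field) `ca(T_(n+1))`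
  has a non-zero element (`𝔪^c ≠ 0` in the domain `T`).
-/

noncomputable section

-- single-problem summit: the doubled namespace component `ResolutionOfSingularities` is forced
set_option linter.dupNamespace false

namespace Summit.ResolutionOfSingularities.ResolutionOfSingularities.Theorems.NoZeno.SandwichCluster

open Summit.ResolutionOfSingularities.ResolutionOfSingularities.Theses.HomologicalConductor
open Summit.ResolutionOfSingularities.ResolutionOfSingularities.Theorems.NoZeno.Birth
open Literature.AlgebraicGeometry.Resolution IsLocalRing
open Literature.RingTheory.CohomologyAnnihilator (cohomologyAnnihilator ca_eq_cohomologyAnnihilator)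

variable {k K : Type} [Field k] [Field K] [Algebra k K]

/-- **`ca(T_(n+1))` is `𝔪`-primary (or the unit ideal)**: some power of the maximal ideal of the
stage `T_(n+1)` lies in its cohomology annihilator.  Every prime `𝔭 ⊇ ca(T_(n+1))` is maximal
(`isMaximal_of_ca_le`), hence equals `𝔪`; so `𝔪 ⊆ √ca`, and `𝔪` is finitely generated
(`stub_towerNoetherian`). [cite: IyengarTakahashi2014, Thm. 5.4] -/
theorem exists_maximalIdeal_pow_le_cohomologyAnnihilator_tower (O : ValuationSubring K)
    (A : Subalgebra k K) (hk : ∀ c : k, algebraMap k K c ∈ O) (hA : A.FG)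
    (hfr : IsFractionRing ↥A K) (hAO : A.toSubring ≤ O.toSubring) (htr : Algebra.trdeg k K = 2)
    (n : ℕ) [IsLocalRing ↥(tower O A (n + 1))] :
    ∃ c : ℕ,
      maximalIdeal ↥(tower O A (n + 1)) ^ c ≤ cohomologyAnnihilator ↥(tower O A (n + 1)) := by
  haveI : IsNoetherianRing ↥(tower O A (n + 1)) := stub_towerNoetherian k K O A hk hA hfr hAO _
  have hrad : maximalIdeal ↥(tower O A (n + 1)) ≤
      (cohomologyAnnihilator ↥(tower O A (n + 1))).radical := by
    rw [Ideal.radical_eq_sInf]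
    refine le_sInf ?_
    rintro 𝔭 ⟨hle, hp⟩
    haveI := hp
    have hmax : 𝔭.IsMaximal :=
      isMaximal_of_ca_le O A hk hA hfr hAO htr n 𝔭 (by rwa [ca_eq_cohomologyAnnihilator])
    exact (IsLocalRing.eq_maximalIdeal hmax).ge
  exact Ideal.exists_pow_le_of_le_radical_of_fg hrad (maximalIdeal _).fg_of_isNoetherianRing

/-- **A non-zero element of `ca(T_(n+1))` at a singular stage**: `T_(n+1)` is not a field (fields
are regular), so `𝔪 ≠ 0`, so `𝔪^c ≠ 0` in the domain `T_(n+1)`, and `𝔪^c ⊆ ca`.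
[cite: IyengarTakahashi2014, Thm. 5.4] -/
theorem exists_ne_zero_mem_cohomologyAnnihilator_tower (O : ValuationSubring K)
    (A : Subalgebra k K) (hk : ∀ c : k, algebraMap k K c ∈ O) (hA : A.FG)
    (hfr : IsFractionRing ↥A K) (hAO : A.toSubring ≤ O.toSubring) (htr : Algebra.trdeg k K = 2)
    (n : ℕ) [IsLocalRing ↥(tower O A (n + 1))] (hsing : ¬ IsRegularLocalRing ↥(tower O A (n + 1))) :
    ∃ y : ↥(tower O A (n + 1)), y ≠ 0 ∧ y ∈ cohomologyAnnihilator ↥(tower O A (n + 1)) := by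
  obtain ⟨c, hc⟩ := exists_maximalIdeal_pow_le_cohomologyAnnihilator_tower O A hk hA hfr hAO htr n
  -- `𝔪 ≠ ⊥`: else `T` is a field, hence regular
  have hm : maximalIdeal ↥(tower O A (n + 1)) ≠ ⊥ := by
    intro h
    exact hsing (isRegularLocalRing_of_isField (IsLocalRing.isField_iff_maximalIdeal_eq.mpr h))
  have hpow : maximalIdeal ↥(tower O A (n + 1)) ^ c ≠ ⊥ := pow_ne_zero c hm
  obtain ⟨y, hy, hy0⟩ := (maximalIdeal ↥(tower O A (n + 1)) ^ c).ne_bot_iff.mp hpow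
  exact ⟨y, hy0, hc hy⟩

end Summit.ResolutionOfSingularities.ResolutionOfSingularities.Theorems.NoZeno.SandwichCluster

end
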